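import Summits.AtomisticToContinuum.BoseEinsteinCondensation.Theorems.BECGroundStateSOSRimSqueezeDefs
import Literature.MathematicalPhysics.QuantumManyBody.PeriodicBoseGasImpurityTranslation
import Literature.MathematicalPhysics.QuantumManyBody.PeriodicBoseGasFracEnergy
import Literature.MathematicalPhysics.QuantumManyBody.BoseGasFreeDirichletBEC
import Mathlib.Algebra.Order.Chebyshev
import HarnessLib

/-!
# Route `BECGroundStateSOS`, crux `BoundaryTransferWeak` (stmt-AtomisticToContinuum-0827),
# line `rim-squeeze-monotone-coherence`: stub (T), auxiliary file (anchor `stub_torusCoreFloor_aux`)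

Overflow helpers of the registered stub `stub_torusCoreFloor` (file
`BECGroundStateSOSBoundaryTransferWeakTorusCoreFloor.lean`): the purely geometric half of the torus
core floor, on the torus of side `L > 0` with `N = n + 1` bosons.

* The 64 half-open sub-cubes `Q_q = qL/4 + [0, L/4)³`, `q ∈ {0,1,2,3}³` (`subCell (L/4) q`), partition
  the cell `[0,L)³`, so Cauchy–Schwarz in the slice variable gives the **sub-cube decomposition**
  `n₀(F) ≤ ∑_q n_{Q_q}(F)` of the condensate occupation (`condensateOccupation_le_sum`), `n_{Q_q}` the
  occupation of the normalised indicator `(L/4)^{-3/2} 1_{Q_q}`;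
* translating the STATE by `t(q) = (L/8)𝟙 - qL/4` carries `Q_q` onto the core cube `C = (L/8, 3L/8)³`
  up to a null set, and the shift of the fundamental cell in the spectators (periodicity) gives
  `n_{Q_q}(Ψ) = d₀(Ψ(· - t(q)𝟙))` (`lintegral_core_sq_eq`), `d₀` the occupation of `coreMode L`;
* **anchor** `stub_torusCoreFloor_aux`: if every translate `Φ = Ψ(· - t𝟙)` of a periodic trial state
  `Ψ` has core occupation `d₀(Φ) ≤ b`, then `n₀(Ψ) ≤ 64 b`.
-/

noncomputable section

namespace Summit.AtomisticToContinuum.BoseEinsteinCondensation.RimSqueeze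

open Literature.MathematicalPhysics.QuantumManyBody.BoseGas MeasureTheory Filter Set
open scoped ENNReal NNReal ComplexConjugate

section Helpers

variable {n : ℕ} {L : ℝ}

/-! ### Arithmetic -/

/-- `‖∑ᵢ aᵢ‖² ≤ #s · ∑ᵢ ‖aᵢ‖²` in `ℝ≥0∞` (Cauchy–Schwarz). [folklore] -/
private theorem ennnorm_sum_sq_le {ι : Type*} (s : Finset ι) (a : ι → ℂ) :
    (‖∑ i ∈ s, a i‖₊ : ℝ≥0∞) ^ 2 ≤ (s.card : ℝ≥0∞) * ∑ i ∈ s, (‖a i‖₊ : ℝ≥0∞) ^ 2 := by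
  -- adapted from …Theorems/BECThomsonPrinciplePeriodicToDirichletTorusFloorFromA.lean
  have h1 : ‖∑ i ∈ s, a i‖₊ ≤ ∑ i ∈ s, ‖a i‖₊ := nnnorm_sum_le s a
  have h2 : (∑ i ∈ s, ‖a i‖₊) ^ 2 ≤ s.card * ∑ i ∈ s, ‖a i‖₊ ^ 2 := sq_sum_le_card_mul_sum_sq
  have h3 : ‖∑ i ∈ s, a i‖₊ ^ 2 ≤ s.card * ∑ i ∈ s, ‖a i‖₊ ^ 2 :=
    (pow_le_pow_left' h1 2).trans h2
  have h4 : ((‖∑ i ∈ s, a i‖₊ ^ 2 : ℝ≥0) : ℝ≥0∞) ≤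
      ((s.card * ∑ i ∈ s, ‖a i‖₊ ^ 2 : ℝ≥0) : ℝ≥0∞) :=
    ENNReal.coe_le_coe.mpr h3
  push_cast at h4
  exact h4

/-- `‖(√v)⁻¹‖₊² = v⁻¹` in `ℝ≥0∞` for `v > 0`. [folklore] -/
private theorem ennnorm_inv_sqrt_sq {v : ℝ} (hv : 0 < v) :
    ((‖((Real.sqrt v : ℝ) : ℂ)⁻¹‖₊ : ℝ≥0∞)) ^ 2 = ENNReal.ofReal v⁻¹ := by
  -- adapted from …Theorems/BECThomsonPrinciplePeriodicToDirichletTorusFloorFromA.lean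
  rw [coe_nnnorm_sq_eq_ofReal, norm_inv, Complex.norm_real,
    Real.norm_of_nonneg (Real.sqrt_nonneg _), inv_pow, Real.sq_sqrt hv.le]

/-- There are `64` sub-cube indices `q ∈ {0,1,2,3}³`. [folklore] -/
private theorem card_subIdx_four : ((Finset.univ : Finset (SubIdx 4)).card : ℝ≥0∞) = 64 := by
  rw [Finset.card_univ, Fintype.card_fun, Fintype.card_fin, Fintype.card_fin]
  norm_num

/-! ### Geometry: the 64 sub-cubes of side `L/4` and the core cube -/

/-- `4 · (L/4) = L` with the natural-number cast. [folklore] -/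
private theorem four_mul_quarter (L : ℝ) : ((4 : ℕ) : ℝ) * (L / 4) = L := by
  push_cast
  ring

/-- Every sub-cube `qL/4 + [0, L/4)³`, `q ∈ {0,1,2,3}³`, lies in the cell `[0,L)³`. [folklore] -/
private theorem subCell_subset_cell₄ (hL : 0 < L) (q : SubIdx 4) : subCell (L / 4) q ⊆ cell L := by
  have h := subCell_subset_cell (k := 4) (by positivity : 0 < L / 4) q
  rwa [four_mul_quarter L] at h

/-- The 64 sub-cubes of side `L/4` cover the cell `[0,L)³`. [folklore] -/
private theorem iUnion_subCell_eq (hL : 0 < L) : ⋃ q : SubIdx 4, subCell (L / 4) q = cell L := by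
  -- adapted from …Theorems/BECThomsonPrinciplePeriodicToDirichletTorusFloorFromA.lean
  ext x
  simp only [Set.mem_iUnion]
  constructor
  · rintro ⟨q, hq⟩
    exact subCell_subset_cell₄ hL q hq
  · intro hx
    rw [← four_mul_quarter L] at hx
    exact exists_mem_subCell (by positivity : 0 < L / 4) hx

/-- Distinct sub-cubes are disjoint. [folklore] -/
private theorem pairwise_disjoint_subCell (hs : 0 < L / 4) :
    Pairwise (Function.onFun Disjoint fun q : SubIdx 4 => subCell (L / 4) q) := fun _ _ hqq' =>
  Set.disjoint_left.mpr fun _ hx => not_mem_subCell_of_ne hs hqq' hx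

/-- **The cell integral of a slice splits over the 64 sub-cubes**:
`∫_cell F(x,Y) dx = ∑_q ∫_{Q_q} F(x,Y) dx`. [folklore] -/
private theorem setIntegral_cell_eq_sum (hL : 0 < L) {F : Config (n + 1) → ℂ}
    (hF : Continuous F) (Y : Config n) :
    ∫ x in cell L, F (Matrix.vecCons x Y) =
      ∑ q : SubIdx 4, ∫ x in subCell (L / 4) q, F (Matrix.vecCons x Y) := by
  -- adapted from …Theorems/BECThomsonPrinciplePeriodicToDirichletTorusFloorFromA.lean
  rw [← iUnion_subCell_eq hL]
  exact integral_iUnion_fintype (fun q => measurableSet_subCell _ q)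
    (pairwise_disjoint_subCell (by positivity)) fun q =>
      (integrableOn_cell (hF.comp (continuous_id.matrixVecCons continuous_const))).mono_set
        (subCell_subset_cell₄ hL q)

/-- The core cube `(L/8, 3L/8)³` lies in the cell (`L > 0`). [folklore] -/
private theorem core_subset_cell (hL : 0 < L) :
    {x : Space | ∀ k, x k ∈ Ioo (L / 8) (3 * L / 8)} ⊆ cell L := fun x hx k => by
  have := hx k
  constructor <;> nlinarith [this.1, this.2]

/-- The shift `t(q)`, `t_k = L/8 - q_k L/4`, carries the sub-cube `Q_q = qL/4 + [0, L/4)³` onto the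
core cube `C = (L/8, 3L/8)³` up to a null set: `C - t(q)` is the interior of `Q_q`. [folklore] -/
private theorem preimage_core_ae_eq_subCell (L : ℝ) (q : SubIdx 4) :
    ((fun x : Space => x + WithLp.toLp 2 fun k => L / 8 - L / 4 * ((q k : ℕ) : ℝ)) ⁻¹'
      {x : Space | ∀ k, x k ∈ Ioo (L / 8) (3 * L / 8)}) =ᵐ[volume] subCell (L / 4) q := by
  -- adapted from `preimage_inner_ae_eq_subCell` of
  -- …Theorems/BECInsertionCorrectorBoundaryTransferWeakTorusTypicality.lean
  have h1 : ((fun x : Space => x + WithLp.toLp 2 fun k => L / 8 - L / 4 * ((q k : ℕ) : ℝ)) ⁻¹'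
      {x : Space | ∀ k, x k ∈ Ioo (L / 8) (3 * L / 8)}) =
      (@WithLp.ofLp 2 (Fin 3 → ℝ)) ⁻¹' (Set.univ.pi fun k =>
        Ioo (L / 4 * ((q k : ℕ) : ℝ)) (L / 4 * ((q k : ℕ) : ℝ) + L / 4)) := by
    ext x
    simp only [Set.mem_preimage, Set.mem_setOf_eq, PiLp.add_apply, Set.mem_Ioo, Set.mem_univ_pi]
    refine forall_congr' fun k => ?_
    constructor <;> rintro ⟨h1, h2⟩ <;> constructor <;> linarith
  have h2 : subCell (L / 4) q = (@WithLp.ofLp 2 (Fin 3 → ℝ)) ⁻¹' (Set.univ.pi fun k =>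
      Ico (L / 4 * ((q k : ℕ) : ℝ)) (L / 4 * ((q k : ℕ) : ℝ) + L / 4)) := by
    ext x
    simp [mem_subCell]
  rw [h1, h2]
  refine (PiLp.volume_preserving_ofLp (Fin 3)).quasiMeasurePreserving.preimage_ae_eq ?_
  rw [volume_pi]
  exact Measure.univ_pi_Ioo_ae_eq_Icc.trans Measure.univ_pi_Ico_ae_eq_Icc.symm

/-- `(y :: Y) - (t, …, t) = (y - t) :: (Y - (t, …, t))`. [folklore] -/
private theorem vecCons_sub_const (y t : Space) (Y : Config n) :
    (Matrix.vecCons y Y - fun _ => t : Config (n + 1)) =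
      Matrix.vecCons (y - t) (Y - fun _ => t) := by
  funext i
  refine Fin.cases ?_ (fun j => ?_) i <;> simp

/-- `x :: (Y + e_m ⊗ u) = (x :: Y) + e_{m+1} ⊗ u`. [folklore] -/
private theorem cons_add_single_succ (x : Space) (Y : Config n) (m : Fin n) (u : Space) :
    (Matrix.vecCons x (Y + Pi.single m u) : Config (n + 1)) =
      Matrix.vecCons x Y + Pi.single m.succ u := by
  -- adapted from …Theorems/BECThomsonPrinciplePeriodicToDirichletTorusLocalCondensation.lean
  funext i
  refine Fin.cases ?_ (fun m' => ?_) i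
  · simp [Ne.symm (Fin.succ_ne_zero m)]
  · by_cases h : m' = m
    · subst h; simp
    · simp [h, Fin.succ_inj]

/-- **Rigid translation of the state**: if `Φ = Ψ(· - t𝟙)` and `C - t = Q_q` a.e. then
`∫_{cellⁿ} |∫_C Φ(y, Y) dy|² dY = ∫_{cellⁿ} |∫_{Q_q} Ψ(x, Y) dx|² dY` (translate `y`, then shift the
fundamental cell `cellⁿ` using periodicity in every spectator). [folklore] -/
private theorem lintegral_core_sq_eq (hL : 0 < L) (Ψ Φ : PeriodicTrialState (n + 1) L)
    (q : SubIdx 4) {t : Space} (hΦ : Φ.ψ = fun X => Ψ.ψ (X - fun _ => t))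
    (hCt : ((fun x => x + t) ⁻¹' {x : Space | ∀ k, x k ∈ Ioo (L / 8) (3 * L / 8)}) =ᵐ[volume]
      subCell (L / 4) q) :
    ∫⁻ Y in cellN n L, (‖∫ y in {x : Space | ∀ k, x k ∈ Ioo (L / 8) (3 * L / 8)},
        Φ.ψ (Matrix.vecCons y Y)‖₊ : ℝ≥0∞) ^ 2 =
      ∫⁻ Y in cellN n L,
        (‖∫ x in subCell (L / 4) q, Ψ.ψ (Matrix.vecCons x Y)‖₊ : ℝ≥0∞) ^ 2 := by
  -- adapted from `lintegral_inner_sq_eq` of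
  -- …Theorems/BECInsertionCorrectorBoundaryTransferWeakTorusTypicality.lean (Bochner slices)
  set C : Set Space := {x : Space | ∀ k, x k ∈ Ioo (L / 8) (3 * L / 8)} with hC
  set K : Config n → ℂ := fun Y => ∫ x in subCell (L / 4) q, Ψ.ψ (Matrix.vecCons x Y) with hK
  have hJ : ∀ Y : Config n, (∫ y in C, Φ.ψ (Matrix.vecCons y Y)) = K (Y - fun _ => t) := fun Y =>
    calc (∫ y in C, Φ.ψ (Matrix.vecCons y Y))
        = ∫ y in C, Ψ.ψ (Matrix.vecCons (y - t) (Y - fun _ => t)) := by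
          simp only [hΦ, vecCons_sub_const]
      _ = ∫ x in (fun x => x + t) ⁻¹' C, Ψ.ψ (Matrix.vecCons x (Y - fun _ => t)) := by
          rw [← (measurePreserving_add_right volume t).setIntegral_preimage_emb
            (measurableEmbedding_addRight t)
            (fun y => Ψ.ψ (Matrix.vecCons (y - t) (Y - fun _ => t))) C]
          simp only [add_sub_cancel_right]
      _ = K (Y - fun _ => t) := setIntegral_congr_set hCt
  have hper : ∀ (Y : Config n) (m : Fin n) (k : Fin 3),
      (fun Y => (‖K Y‖₊ : ℝ≥0∞) ^ 2) (Y + Pi.single m (EuclideanSpace.single k L)) =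
        (fun Y => (‖K Y‖₊ : ℝ≥0∞) ^ 2) Y := by
    intro Y m k
    simp only [hK, cons_add_single_succ, Ψ.periodic]
  calc ∫⁻ Y in cellN n L, (‖∫ y in C, Φ.ψ (Matrix.vecCons y Y)‖₊ : ℝ≥0∞) ^ 2
      = ∫⁻ Y in cellN n L, (fun Y => (‖K Y‖₊ : ℝ≥0∞) ^ 2) (Y + -fun _ => t) :=
        lintegral_congr fun Y => by rw [hJ, sub_eq_add_neg]
    _ = ∫⁻ Y in cellN n L, (‖K Y‖₊ : ℝ≥0∞) ^ 2 :=
        lintegral_cellN_comp_add hL (G := fun Y => (‖K Y‖₊ : ℝ≥0∞) ^ 2) hper _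

/-! ### Occupations of flat modes through slices -/

/-- **Occupation of the flat mode `c·1_Q`** of a measurable `Q ⊆ cell`:
`(n+1) ∫_{cellⁿ} ‖c‖² |∫_Q F(x,Y) dx|² dY`. [folklore] -/
private theorem cellOccupation_indicator_const (L : ℝ) {Q : Set Space} (hQ : MeasurableSet Q)
    (hQc : Q ⊆ cell L) (c : ℂ) (F : Config (n + 1) → ℂ) :
    cellOccupation (n + 1) L (Q.indicator fun _ => c) F =
      (n + 1 : ℝ≥0∞) * ∫⁻ Y in cellN n L,
        (‖c‖₊ : ℝ≥0∞) ^ 2 * (‖∫ x in Q, F (Matrix.vecCons x Y)‖₊ : ℝ≥0∞) ^ 2 := by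
  -- adapted from …Theorems/BECThomsonPrinciplePeriodicToDirichletTorusFloorFromA.lean
  rw [cellOccupation_succ]
  congr 1
  refine lintegral_congr fun Y => ?_
  have hind : (fun x => conj (Q.indicator (fun _ => c) x) * F (Matrix.vecCons x Y)) =
      Q.indicator fun x => conj c * F (Matrix.vecCons x Y) := by
    funext x
    by_cases hx : x ∈ Q
    · simp [hx]
    · simp [hx]
  rw [hind, integral_indicator hQ, Measure.restrict_restrict hQ, Set.inter_eq_left.mpr hQc,
    integral_const_mul, nnnorm_mul, RCLike.nnnorm_conj, ENNReal.coe_mul, mul_pow]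

/-- **The core occupation through slices**: `d₀(F) = (n+1) ‖c₁‖² ∫_{cellⁿ} |∫_C F(x,Y) dx|² dY`,
`c₁ = (L/4)^{-3/2}`, `C = (L/8, 3L/8)³`. [folklore] -/
private theorem cellOccupation_coreMode_eq (hL : 0 < L) (F : Config (n + 1) → ℂ) :
    cellOccupation (n + 1) L (coreMode L) F =
      (n + 1 : ℝ≥0∞) * ((‖((Real.sqrt ((L / 4) ^ 3))⁻¹ : ℂ)‖₊ : ℝ≥0∞) ^ 2 *
        ∫⁻ Y in cellN n L, (‖∫ x in {x : Space | ∀ k, x k ∈ Ioo (L / 8) (3 * L / 8)},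
          F (Matrix.vecCons x Y)‖₊ : ℝ≥0∞) ^ 2) := by
  unfold coreMode
  rw [cellOccupation_indicator_const L (measurableSet_core L) (core_subset_cell hL) _ F,
    lintegral_const_mul' _ _ (ENNReal.pow_ne_top ENNReal.coe_ne_top)]

/-- **Sub-cube decomposition of the condensate occupation** (Cauchy–Schwarz over the 64 sub-cubes
of side `L/4`): `n₀(F) ≤ ∑_q (n+1) ‖c₁‖² ∫_{cellⁿ} |∫_{Q_q} F(x,Y) dx|² dY` (`= ∑_q n_{Q_q}(F)`), since
`L⁻³ |∑_q a_q|² ≤ 64 L⁻³ ∑_q |a_q|² = ‖c₁‖² ∑_q |a_q|²`. [folklore] -/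
private theorem condensateOccupation_le_sum (hL : 0 < L) {F : Config (n + 1) → ℂ}
    (hF : Continuous F) :
    condensateOccupation (n + 1) L F ≤ ∑ q : SubIdx 4,
      (n + 1 : ℝ≥0∞) * ((‖((Real.sqrt ((L / 4) ^ 3))⁻¹ : ℂ)‖₊ : ℝ≥0∞) ^ 2 *
        ∫⁻ Y in cellN n L, (‖∫ x in subCell (L / 4) q, F (Matrix.vecCons x Y)‖₊ : ℝ≥0∞) ^ 2) := by
  -- adapted from `condensateOccupation_le_eight_mul` of
  -- …Theorems/BECThomsonPrinciplePeriodicToDirichletTorusFloorFromA.lean (k = 4, no rigidity)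
  set c₀ : ℂ := ((Real.sqrt (L ^ 3))⁻¹ : ℂ)
  set c₁ : ℂ := ((Real.sqrt ((L / 4) ^ 3))⁻¹ : ℂ) with hc₁
  have hn₀ : ((‖c₀‖₊ : ℝ≥0∞)) ^ 2 = ENNReal.ofReal (L ^ 3)⁻¹ := ennnorm_inv_sqrt_sq (by positivity)
  have hn₁ : ((‖c₁‖₊ : ℝ≥0∞)) ^ 2 = 64 * ENNReal.ofReal (L ^ 3)⁻¹ := by
    have h : ((L / 4) ^ 3)⁻¹ = 64 * (L ^ 3)⁻¹ := by
      rw [div_pow, inv_div, div_eq_mul_inv]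
      norm_num
    rw [hc₁, ennnorm_inv_sqrt_sq (by positivity), h, ENNReal.ofReal_mul (by norm_num),
      ENNReal.ofReal_ofNat]
  have hLHS : condensateOccupation (n + 1) L F = cellOccupation (n + 1) L (fun _ => c₀) F := rfl
  have hpt₀ : ∀ Y : Config n,
      (‖∫ x in cell L, conj c₀ * F (Matrix.vecCons x Y)‖₊ : ℝ≥0∞) ^ 2 =
        (‖c₀‖₊ : ℝ≥0∞) ^ 2 *
          (‖∑ q : SubIdx 4, ∫ x in subCell (L / 4) q, F (Matrix.vecCons x Y)‖₊ : ℝ≥0∞) ^ 2 := by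
    intro Y
    rw [integral_const_mul, setIntegral_cell_eq_sum hL hF Y, nnnorm_mul,
      RCLike.nnnorm_conj, ENNReal.coe_mul, mul_pow]
  have hmeas : ∀ q : SubIdx 4, Measurable fun Y : Config n =>
      (‖∫ x in subCell (L / 4) q, F (Matrix.vecCons x Y)‖₊ : ℝ≥0∞) ^ 2 :=
    fun q => measurable_sliceSetIntegral_sq hF _
  have hCS : ∀ Y : Config n,
      (‖∑ q : SubIdx 4, ∫ x in subCell (L / 4) q, F (Matrix.vecCons x Y)‖₊ : ℝ≥0∞) ^ 2 ≤
        64 * ∑ q : SubIdx 4,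
          (‖∫ x in subCell (L / 4) q, F (Matrix.vecCons x Y)‖₊ : ℝ≥0∞) ^ 2 := fun Y => by
    have h := ennnorm_sum_sq_le Finset.univ
      (fun q : SubIdx 4 => ∫ x in subCell (L / 4) q, F (Matrix.vecCons x Y))
    rwa [card_subIdx_four] at h
  have htop₀ : ((‖c₀‖₊ : ℝ≥0∞)) ^ 2 ≠ ⊤ := ENNReal.pow_ne_top ENNReal.coe_ne_top
  rw [hLHS, cellOccupation_succ]
  simp only [hpt₀]
  calc (n + 1 : ℝ≥0∞) * ∫⁻ Y in cellN n L, (‖c₀‖₊ : ℝ≥0∞) ^ 2 *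
          (‖∑ q : SubIdx 4, ∫ x in subCell (L / 4) q, F (Matrix.vecCons x Y)‖₊ : ℝ≥0∞) ^ 2
      ≤ (n + 1 : ℝ≥0∞) * ∫⁻ Y in cellN n L, (‖c₀‖₊ : ℝ≥0∞) ^ 2 * (64 *
          ∑ q : SubIdx 4,
            (‖∫ x in subCell (L / 4) q, F (Matrix.vecCons x Y)‖₊ : ℝ≥0∞) ^ 2) := by
        gcongr with Y
        exact hCS Y
    _ = (n + 1 : ℝ≥0∞) * ((‖c₀‖₊ : ℝ≥0∞) ^ 2 * (64 *
          ∑ q : SubIdx 4, ∫⁻ Y in cellN n L,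
            (‖∫ x in subCell (L / 4) q, F (Matrix.vecCons x Y)‖₊ : ℝ≥0∞) ^ 2)) := by
        rw [lintegral_const_mul' _ _ htop₀, lintegral_const_mul' _ _ ENNReal.ofNat_ne_top,
          lintegral_finsetSum _ fun q _ => hmeas q]
    _ = ∑ q : SubIdx 4, (n + 1 : ℝ≥0∞) * ((‖c₁‖₊ : ℝ≥0∞) ^ 2 * ∫⁻ Y in cellN n L,
            (‖∫ x in subCell (L / 4) q, F (Matrix.vecCons x Y)‖₊ : ℝ≥0∞) ^ 2) := by
        rw [hn₀, hn₁, Finset.mul_sum, Finset.mul_sum, Finset.mul_sum]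
        refine Finset.sum_congr rfl fun q _ => ?_
        ring

end Helpers

/-- **Anchor `stub_torusCoreFloor_aux` (stub (T), auxiliary half): local from global condensation
by translating the state.** On the torus of side `L > 0` with `N = n + 1` bosons: if every rigid
translate `Φ = Ψ(· - t𝟙)`, `t ∈ ℝ³`, of a periodic trial state `Ψ` has core occupation
`cellOccupation (n+1) L (coreMode L) Φ.ψ ≤ b`, then the constant-mode occupation of `Ψ` is at most
`64 b` — the cell is tiled by the 64 sub-cubes of side `L/4`, `n₀ ≤ ∑_q n_{Q_q}` by Cauchy–Schwarz,
and `n_{Q_q}(Ψ)` is the core occupation of the translate moving `Q_q` onto the core cube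
`(L/8, 3L/8)³`. [folklore] -/
theorem stub_torusCoreFloor_aux : ∀ (n : ℕ) (L : ℝ), 0 < L → ∀ (Ψ : PeriodicTrialState (n + 1) L) (b : ℝ≥0∞), (∀ (t : Space) (Φ : PeriodicTrialState (n + 1) L), (Φ.ψ = fun X => Ψ.ψ (X - fun _ => t)) → cellOccupation (n + 1) L (coreMode L) Φ.ψ ≤ b) → condensateOccupation (n + 1) L Ψ.ψ ≤ 64 * b := by
  intro n L hL Ψ b hb
  calc condensateOccupation (n + 1) L Ψ.ψ
      ≤ ∑ q : SubIdx 4, (n + 1 : ℝ≥0∞) * ((‖((Real.sqrt ((L / 4) ^ 3))⁻¹ : ℂ)‖₊ : ℝ≥0∞) ^ 2 *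
          ∫⁻ Y in cellN n L,
            (‖∫ x in subCell (L / 4) q, Ψ.ψ (Matrix.vecCons x Y)‖₊ : ℝ≥0∞) ^ 2) :=
        condensateOccupation_le_sum hL Ψ.contDiff.continuous
    _ ≤ ∑ _q : SubIdx 4, b := Finset.sum_le_sum fun q _ => by
        -- the translate moving `Q_q` onto the core cube
        obtain ⟨Φ, hΦ⟩ :=
          Ψ.exists_translate (WithLp.toLp 2 fun k => L / 8 - L / 4 * ((q k : ℕ) : ℝ))
        calc (n + 1 : ℝ≥0∞) * ((‖((Real.sqrt ((L / 4) ^ 3))⁻¹ : ℂ)‖₊ : ℝ≥0∞) ^ 2 *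
              ∫⁻ Y in cellN n L,
                (‖∫ x in subCell (L / 4) q, Ψ.ψ (Matrix.vecCons x Y)‖₊ : ℝ≥0∞) ^ 2)
            = cellOccupation (n + 1) L (coreMode L) Φ.ψ := by
              rw [cellOccupation_coreMode_eq hL,
                lintegral_core_sq_eq hL Ψ Φ q hΦ (preimage_core_ae_eq_subCell L q)]
          _ ≤ b := hb _ Φ hΦ
    _ = 64 * b := by rw [Finset.sum_const, nsmul_eq_mul, card_subIdx_four]

end Summit.AtomisticToContinuum.BoseEinsteinCondensation.RimSqueeze

end
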